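import Summits.QuantumFields.YangMills.Theorems.BalabanUVNodesN22W1FadingMemoryOfCouplingRadii
import Summits.QuantumFields.YangMills.Theorems.BalabanUVNodesN22W1YoungLipschitzOfCouplingHoloVertex

/-!
# BalabanUVNodes ∕ node N22 = NE9 — FADING MEMORY FROM AGE-GROWING COUPLING RADII, THE VERTEX TWIN: node N22's statement SHAPE
# `NE9 ∧ FadingMemory` for the W1 history functional with NO uniform margin in the LAST coupling (relative discs `D̄(s, c·s)` there, dag-n22-c's J31b),
# age-growing radii in the OLDER couplings only

Cell `pub-ymgap`, HUMAN RULING D-0062 (Track A) ∕ D-0149, WIDTH SEAT `pub-ymgap-dag-n22-w1` (g2) on node n22 = NE9; `--kind proof --supports stmt-QuantumFields-20544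
--as helper` (K3⁷ `SpineGivenEndpointR13SepCoPH`), COUNT-NEUTRAL.  Sibling of this seat's `…N22W1FadingMemoryOfCouplingRadii` (p606932), typed on dag-n22-c g12's
VERTEX EDITION J31b `…N22W1YoungLipschitzOfCouplingHoloVertex` (p606684) — both imported BY NAME; THEOREMS ONLY (0 `def`, 0 `sorry`, standard axioms).

WHY.  §2 of p606932 (`ne9_and_fadingMemory_functionalOn_of_coordHoloRadii`) reads J31's BOX datum, whose age-one entry asks a UNIFORM complex margin `ϱ·ω⁻¹` in
the LAST coupling over `]0, γ]` — displayed there as a hypothesis NOT claimed at the vertex (`T4CouplingAnalyticity` (L5)∕[H-dil]: in the printed scheme the last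
coupling is a dilation parameter of the step's integration variables, [II] (2.5)–(2.10)).  J31b replaces that entry by the VERTEX datum: holomorphy on RELATIVE
discs `D̄(s, c·s)` with an activity bound `A′·s·e^{−R d_{k+1}(Z)}` vanishing LINEARLY at `s → 0`, giving the `g`-independent letter `8A′∕min(c,1)` at age one and
the table `if i < k then 4A∕ρ i else 8A′∕min(c,1)` (`youngLipschitz_box_of_coordHolo_vertex`), with `Bound238` at amplitude `A′·γ` (`bound238_box_of_coordHoloLast`).
p606932 §1b (`fadingMemory_of_couplingRadii_lastLetter`) shows such a MIXED table fades with `C₉ = max (4A∕ϱ) (L∕ω)` when the OLDER radii grow with the age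
and `0 < ω ≤ 1`.  THIS MODULE composes the three with dag-n22-c g0's Road-1 knit: node N22's SHAPE for `W1.functionalOn S p emb` from the vertex-honest datum.

WHAT.
* `vertexTable_eq_lastLetterTable` — the re-indexing `(fun i : Fin (k+1) ↦ if i < k then a i else L) = (fun i ↦ if i + 1 < k + 1 then a i else L)` (bookkeeping).
* ★ `ne9_and_fadingMemory_functionalOn_of_coordHoloRadii_vertex` — for W1's tower `S` on the `K`-th torus, backgrounds read inside the space tables, Road 1's numerals AT
  THE AMPLITUDE `A′·γ` (`0 < A′`, `0 < γ`, `2·(A′γ)·e^{5r₁+1}·K₀(64,8)·9·64 ≤ 1`, `κ ≤ r₁`, `r₁ + 2·64·log 162 + 2 ≤ R`), a radius table for the OLDER couplings with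
  `ϱ·(ω^{k−i})⁻¹ ≤ ρ k i` for `i + 1 < k` (`0 < ϱ`, `0 < ω ≤ 1`), relative-disc slope `c > 0`, and at every level `k` J31b's two data (older coordinates `i < k` on
  uniform margins `ρ (k+1) i` with bound `A·e^{−R d}`; the last coordinate on `D̄(s, c·s)` with bound `A′·s·e^{−R d}`) ⟹
  `NE9 (W1.functionalOn S p emb) (Window γ) κ Λ ∧ FadingMemory (c₀·max (4A∕ϱ) ((8A′∕min(c,1))∕ω)) ω Λ`, `Λ k i = c₀·(if i + 1 < k then 4A∕ρ k i else 8A′∕min(c,1))`,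
  `c₀ = 8·e·9·64·K₀(64,8)²`; `…_functional_…_vertex` (`emb := ofBackgroundC ι`).
* `ne9_functionalOn_letterModuli_of_coordHoloRadii_vertex` — the `ℓ.moduli` face: radii of the older couplings growing against `ℓ.ω` (`ℓ.ω ≤ 1`) and
  `c₀·max (4A∕ϱ) ((8A′∕min(c,1))∕ℓ.ω) ≤ ℓ.C₉` ⟹ `NE9 (W1.functionalOn S p emb) (Window γ) κ ℓ.moduli` (dag-n22-e's `YMDAG.N22.ne9_of_moduli_le`).
* RIDER (A5) `ne9_and_fadingMemory_termlessTower_vertex` — the ★ fires on the termless MODEL tower (J31 `coordHolo_termlessStep` for the older data, J31b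
  `coordHoloRel_termlessStep` for the last) — not vacuous; a model tower, NOT NODE 00's.

HONEST FRAMING.  Count-neutral helper ∕ junction (by-name composition + real arithmetic).  DISPLAYED, asserted nowhere: J31b's two data at the towers (node N10's Lemma 3
complexified in the couplings ∕ NODE A at the towers of record; the relative last-coupling datum is the cell's reading of print's dilation, NOT a printed estimate) and the
located letter «radius growth in the age of the OLDER couplings».  Print: «C^∞ (or analytic)» in the last coupling only ([I] p. 263), no radius.  Nothing of Bałaban's
constructed; N22 NOT discharged (typed 28∕28 · discharged 5∕27 UNCHANGED — the chair's single count line is the only count); K3⁷ OPEN, NOT claimed; NE9 ∕ `FadingMemory` NOT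
IN PRINT for d = 4; one finite four-torus programme at fixed ε — R4 closes the CONDITIONAL rung `BalabanLadder.UV` only; NOT infinite volume, NOT OS on ℝ⁴, NOT a mass gap,
NOT Clay.

References (TYPES only): [I] = [Balaban1987RG1] Commun. Math. Phys. **109** (1987) — §1 p. 263, §2 p. 266, §5 p. 298; [II] = [Balaban1988RG2Cluster] Commun. Math. Phys.
**116** (1988) — (2.5)–(2.10) pp. 12–14, (2.13) p. 14, Lemma 3 (2.38) p. 20, (2.39)–(2.41) p. 21; Cauchy mechanisms as typed in `Dimock2015.AnalyticLipschitz` and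
`T4CouplingAnalyticity` §9 ([DimockYuan2024GNFlow]).
-/

noncomputable section

namespace YMDAG.N22.W1.CouplingRadii

open Set Metric
open scoped BigOperators
open Literature.MathematicalPhysics.QuantumFieldTheory.Balaban1983to89
open Literature.MathematicalPhysics.QuantumFieldTheory.Balaban1983to89.T4Continuum (T4Family)
open Literature.MathematicalPhysics.QuantumFieldTheory.Balaban1983to89.T4OutputRate
open Literature.MathematicalPhysics.QuantumFieldTheory.Balaban1983to89.B12TreeDecay (K₀ K₀_pos)
open Literature.MathematicalPhysics.QuantumFieldTheory.Balaban1983to89.Node00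
open Literature.MathematicalPhysics.QuantumFieldTheory.Balaban1983to89.Node00.Sect2 (domSys CPair ofBackgroundC)
open Literature.MathematicalPhysics.QuantumFieldTheory.Balaban1983to89.Node00.W1
open YMDAG.N22.W1 (ne9_and_fadingMemory_functionalOn_of_youngLipschitz bound238_box_of_coordHoloLast youngLipschitz_box_of_coordHolo_vertex
  coordHolo_termlessStep coordHoloRel_termlessStep)

/-- Re-indexing of the vertex table: `i < k ⟺ i + 1 < k + 1` on `Fin (k+1)`. [folklore] -/
theorem vertexTable_eq_lastLetterTable {k : ℕ} (a : Fin (k + 1) → ℝ) (L : ℝ) :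
    (fun i : Fin (k + 1) => if (i : ℕ) < k then a i else L) = fun i : Fin (k + 1) => if (i : ℕ) + 1 < k + 1 then a i else L := by
  funext i
  simp only [Nat.add_lt_add_iff_right]

section W1Functional
variable (F : T4Family) (K : ℕ) {𝔸 : Type*} {M : ℕ}

open Classical in
/-- **★ `NE9 ∧ FadingMemory` FOR THE W1 HISTORY FUNCTIONAL FROM THE VERTEX-HONEST DATUM.**  J31b's two data at every level — the OLDER couplings `i < k` on uniform
margins `ρ (k+1) i` with the (2.38) amplitude `A`, the LAST coupling on relative discs `D̄(s, c·s)` with bound `A′·s·e^{−R d_{k+1}(Z)}` — together with age-growing radii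
in the older couplings (`ϱ·(ω^{k−i})⁻¹ ≤ ρ k i` for `i + 1 < k`, `0 < ω ≤ 1`) and Road 1's numerals at the amplitude `A′·γ` give node N22's statement shape for
`W1.functionalOn S p emb` with the mixed table `Λ k i = c₀·(if i + 1 < k then 4A∕ρ k i else 8A′∕min(c,1))` and `FadingMemory (c₀·max (4A∕ϱ) ((8A′∕min(c,1))∕ω)) ω Λ`.
NO uniform margin in the last coupling is asked.  By name: J31b `bound238_box_of_coordHoloLast` ∕ `youngLipschitz_box_of_coordHolo_vertex`, p606932 §1b, dag-n22-c g0's knit.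
[cite: Balaban1987RG1, §1 p.263, §2 p.266 and §5 p.298; Balaban1988RG2Cluster, (2.5)-(2.10) pp.12-14, (2.13) p.14, Lemma 3 (2.38) p.20 and (2.39)-(2.41) p.21] -/
theorem ne9_and_fadingMemory_functionalOn_of_coordHoloRadii_vertex (S : ClusterTower (F.P K) 𝔸 M) (p : RunPairing) {B : Type}
    (emb : B → CPair (F.P K) 𝔸) (sp : (k : ℕ) → (domSys (F.P K) M (k + 1)).Dom → Set (CPair (F.P K) 𝔸))
    (hsp : ∀ (k : ℕ) (U : B) Z, emb U ∈ sp k Z) {γ κ A A' R r₁ ϱ ω c : ℝ} (hA : 0 ≤ A) (hA' : 0 < A') (hγ : 0 < γ) (hr₁ : 0 ≤ r₁) (hκ : κ ≤ r₁)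
    (hrate : r₁ + 2 * (64 * Real.log 162) + 2 ≤ R) (hsmall : 2 * (A' * γ) * Real.exp (5 * r₁ + 1) * K₀ 64 8 * 9 * 64 ≤ 1)
    (hϱ : 0 < ϱ) (hω : 0 < ω) (hω1 : ω ≤ 1) (hc : 0 < c) (ρ : ℕ → ℕ → ℝ) (hρpos : ∀ k i, 0 < ρ k i)
    (hρ : ∀ k i, i + 1 < k → ϱ * (ω ^ (k - i))⁻¹ ≤ ρ k i)
    (hOld : ∀ k, ∀ g ∈ box γ k, ∀ Z, ∀ φ ∈ sp k Z, ∀ i : Fin (k + 1), (i : ℕ) < k →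
      ∃ (Hc : ℂ → ℂ) (O : Set ℂ), DifferentiableOn ℂ Hc O ∧ (∀ t ∈ Ioc (0 : ℝ) γ, closedBall (t : ℂ) (ρ (k + 1) i) ⊆ O) ∧
        (∀ z ∈ O, ‖Hc z‖ ≤ A * Real.exp (-(R * (domSys (F.P K) M (k + 1)).dj Z))) ∧
        (∀ t ∈ Ioc (0 : ℝ) γ, Hc t = (S k).H (Function.update g i t) φ Z))
    (hLast : ∀ k, ∀ g ∈ box γ k, ∀ Z, ∀ φ ∈ sp k Z,
      ∃ (Hc : ℂ → ℂ) (O : Set ℂ), DifferentiableOn ℂ Hc O ∧ (∀ s ∈ Ioc (0 : ℝ) γ, closedBall (s : ℂ) (c * s) ⊆ O) ∧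
        (∀ s ∈ Ioc (0 : ℝ) γ, ∀ z ∈ closedBall (s : ℂ) (c * s), ‖Hc z‖ ≤ A' * s * Real.exp (-(R * (domSys (F.P K) M (k + 1)).dj Z))) ∧
        (∀ t ∈ Ioc (0 : ℝ) γ, Hc t = (S k).H (Function.update g (Fin.last k) t) φ Z)) :
    NE9 (functionalOn S p emb) (Window γ) κ
        (fun n i => 8 * (Real.exp 1 * 9 * 64 * K₀ 64 8 ^ 2) * (if i + 1 < n then 4 * A / ρ n i else 8 * A' / min c 1)) ∧
      FadingMemory (8 * (Real.exp 1 * 9 * 64 * K₀ 64 8 ^ 2) * max (4 * A / ϱ) (8 * A' / min c 1 / ω)) ω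
        (fun n i => 8 * (Real.exp 1 * 9 * 64 * K₀ 64 8 ^ 2) * (if i + 1 < n then 4 * A / ρ n i else 8 * A' / min c 1)) := by
  have hL : 0 ≤ 8 * A' / min c 1 := div_nonneg (by positivity) (le_min hc.le zero_le_one)
  have hYL : ∀ k, (S k).YoungLipschitz (box γ k) (sp k)
      (fun i : Fin (k + 1) => if (i : ℕ) + 1 < k + 1 then 4 * A / ρ (k + 1) i else 8 * A' / min c 1) R := by
    intro k
    rw [← vertexTable_eq_lastLetterTable (fun i : Fin (k + 1) => 4 * A / ρ (k + 1) i) (8 * A' / min c 1)]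
    exact youngLipschitz_box_of_coordHolo_vertex (S k) (sp k) (fun i => ρ (k + 1) i) (fun i => hρpos _ _) hc (hOld k) (hLast k)
  exact ne9_and_fadingMemory_functionalOn_of_youngLipschitz F K S p emb sp hsp
    (fun n i => if i + 1 < n then 4 * A / ρ n i else 8 * A' / min c 1) (mul_pos hA' hγ) hr₁ hκ hrate hsmall
    (fadingMemory_of_couplingRadii_lastLetter hA hϱ hω hω1 hL hρ)
    (fun k => bound238_box_of_coordHoloLast (S k) (sp k) hA'.le hc (hLast k)) hYL

open Classical in
/-- **THE SAME FOR THE FUNCTIONAL OF RECORD `W1.functional S ι p`** (`emb := Sect2.ofBackgroundC ι`). [cite: Balaban1987RG1, (0.24) p.257, §1 p.263 and §5 p.298] -/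
theorem ne9_and_fadingMemory_functional_of_coordHoloRadii_vertex [Ring 𝔸] (S : ClusterTower (F.P K) 𝔸 M) {G : Type} [Group G] (ι : G →* 𝔸ˣ)
    (p : RunPairing) (sp : (k : ℕ) → (domSys (F.P K) M (k + 1)).Dom → Set (CPair (F.P K) 𝔸))
    (hsp : ∀ (k : ℕ) (U : GaugeField (F.P K) 0 G) Z, ofBackgroundC ι U ∈ sp k Z) {γ κ A A' R r₁ ϱ ω c : ℝ} (hA : 0 ≤ A) (hA' : 0 < A')
    (hγ : 0 < γ) (hr₁ : 0 ≤ r₁) (hκ : κ ≤ r₁) (hrate : r₁ + 2 * (64 * Real.log 162) + 2 ≤ R)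
    (hsmall : 2 * (A' * γ) * Real.exp (5 * r₁ + 1) * K₀ 64 8 * 9 * 64 ≤ 1) (hϱ : 0 < ϱ) (hω : 0 < ω) (hω1 : ω ≤ 1) (hc : 0 < c)
    (ρ : ℕ → ℕ → ℝ) (hρpos : ∀ k i, 0 < ρ k i) (hρ : ∀ k i, i + 1 < k → ϱ * (ω ^ (k - i))⁻¹ ≤ ρ k i)
    (hOld : ∀ k, ∀ g ∈ box γ k, ∀ Z, ∀ φ ∈ sp k Z, ∀ i : Fin (k + 1), (i : ℕ) < k →
      ∃ (Hc : ℂ → ℂ) (O : Set ℂ), DifferentiableOn ℂ Hc O ∧ (∀ t ∈ Ioc (0 : ℝ) γ, closedBall (t : ℂ) (ρ (k + 1) i) ⊆ O) ∧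
        (∀ z ∈ O, ‖Hc z‖ ≤ A * Real.exp (-(R * (domSys (F.P K) M (k + 1)).dj Z))) ∧
        (∀ t ∈ Ioc (0 : ℝ) γ, Hc t = (S k).H (Function.update g i t) φ Z))
    (hLast : ∀ k, ∀ g ∈ box γ k, ∀ Z, ∀ φ ∈ sp k Z,
      ∃ (Hc : ℂ → ℂ) (O : Set ℂ), DifferentiableOn ℂ Hc O ∧ (∀ s ∈ Ioc (0 : ℝ) γ, closedBall (s : ℂ) (c * s) ⊆ O) ∧
        (∀ s ∈ Ioc (0 : ℝ) γ, ∀ z ∈ closedBall (s : ℂ) (c * s), ‖Hc z‖ ≤ A' * s * Real.exp (-(R * (domSys (F.P K) M (k + 1)).dj Z))) ∧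
        (∀ t ∈ Ioc (0 : ℝ) γ, Hc t = (S k).H (Function.update g (Fin.last k) t) φ Z)) :
    NE9 (functional S ι p) (Window γ) κ
        (fun n i => 8 * (Real.exp 1 * 9 * 64 * K₀ 64 8 ^ 2) * (if i + 1 < n then 4 * A / ρ n i else 8 * A' / min c 1)) ∧
      FadingMemory (8 * (Real.exp 1 * 9 * 64 * K₀ 64 8 ^ 2) * max (4 * A / ϱ) (8 * A' / min c 1 / ω)) ω
        (fun n i => 8 * (Real.exp 1 * 9 * 64 * K₀ 64 8 ^ 2) * (if i + 1 < n then 4 * A / ρ n i else 8 * A' / min c 1)) :=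
  ne9_and_fadingMemory_functionalOn_of_coordHoloRadii_vertex F K S p (ofBackgroundC ι) sp hsp hA hA' hγ hr₁ hκ hrate hsmall hϱ hω hω1 hc ρ hρpos hρ
    hOld hLast

open Classical in
/-- **THE `ℓ.moduli` FACE AT THE VERTEX**: with the older radii growing against a letter block's rate `ℓ.ω ≤ 1` and `c₀·max (4A∕ϱ) ((8A′∕min(c,1))∕ℓ.ω) ≤ ℓ.C₉`, the W1
functional carries `NE9 … (Window γ) κ ℓ.moduli` (the ★ + `FadingMemory`'s entrywise bound + dag-n22-e's `YMDAG.N22.ne9_of_moduli_le`).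
[cite: Balaban1987RG1, (1.18) p.263 and (1.20)-(1.22) p.264; Balaban1988RG2Cluster, (2.13) p.14 and (2.38) p.20] -/
theorem ne9_functionalOn_letterModuli_of_coordHoloRadii_vertex (S : ClusterTower (F.P K) 𝔸 M) (p : RunPairing) {B : Type}
    (emb : B → CPair (F.P K) 𝔸) (sp : (k : ℕ) → (domSys (F.P K) M (k + 1)).Dom → Set (CPair (F.P K) 𝔸))
    (hsp : ∀ (k : ℕ) (U : B) Z, emb U ∈ sp k Z) {γ κ A A' R r₁ ϱ c : ℝ} (hA : 0 ≤ A) (hA' : 0 < A') (hγ : 0 < γ) (hr₁ : 0 ≤ r₁) (hκ : κ ≤ r₁)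
    (hrate : r₁ + 2 * (64 * Real.log 162) + 2 ≤ R) (hsmall : 2 * (A' * γ) * Real.exp (5 * r₁ + 1) * K₀ 64 8 * 9 * 64 ≤ 1)
    (hϱ : 0 < ϱ) (hc : 0 < c) (ℓ : U3Letters₁₁) (hω : 0 < ℓ.ω) (hω1 : ℓ.ω ≤ 1) (ρ : ℕ → ℕ → ℝ) (hρpos : ∀ k i, 0 < ρ k i)
    (hρ : ∀ k i, i + 1 < k → ϱ * (ℓ.ω ^ (k - i))⁻¹ ≤ ρ k i)
    (hC₉ : 8 * (Real.exp 1 * 9 * 64 * K₀ 64 8 ^ 2) * max (4 * A / ϱ) (8 * A' / min c 1 / ℓ.ω) ≤ ℓ.C₉)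
    (hOld : ∀ k, ∀ g ∈ box γ k, ∀ Z, ∀ φ ∈ sp k Z, ∀ i : Fin (k + 1), (i : ℕ) < k →
      ∃ (Hc : ℂ → ℂ) (O : Set ℂ), DifferentiableOn ℂ Hc O ∧ (∀ t ∈ Ioc (0 : ℝ) γ, closedBall (t : ℂ) (ρ (k + 1) i) ⊆ O) ∧
        (∀ z ∈ O, ‖Hc z‖ ≤ A * Real.exp (-(R * (domSys (F.P K) M (k + 1)).dj Z))) ∧
        (∀ t ∈ Ioc (0 : ℝ) γ, Hc t = (S k).H (Function.update g i t) φ Z))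
    (hLast : ∀ k, ∀ g ∈ box γ k, ∀ Z, ∀ φ ∈ sp k Z,
      ∃ (Hc : ℂ → ℂ) (O : Set ℂ), DifferentiableOn ℂ Hc O ∧ (∀ s ∈ Ioc (0 : ℝ) γ, closedBall (s : ℂ) (c * s) ⊆ O) ∧
        (∀ s ∈ Ioc (0 : ℝ) γ, ∀ z ∈ closedBall (s : ℂ) (c * s), ‖Hc z‖ ≤ A' * s * Real.exp (-(R * (domSys (F.P K) M (k + 1)).dj Z))) ∧
        (∀ t ∈ Ioc (0 : ℝ) γ, Hc t = (S k).H (Function.update g (Fin.last k) t) φ Z)) :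
    NE9 (functionalOn S p emb) (Window γ) κ ℓ.moduli := by
  obtain ⟨h9, hfade⟩ := ne9_and_fadingMemory_functionalOn_of_coordHoloRadii_vertex F K S p emb sp hsp hA hA' hγ hr₁ hκ hrate hsmall hϱ hω hω1 hc ρ
    hρpos hρ hOld hLast
  refine ne9_of_moduli_le (fun k i hi => ?_) h9
  rw [U3Letters₁₁.moduli_apply]
  exact (hfade k i hi.le).2.trans (mul_le_mul_of_nonneg_right hC₉ (pow_nonneg hω.le _))

end W1Functional

/-! ## RIDER (A5): the ★ fires on the termless model tower -/

section Rider
variable (F : T4Family) (K : ℕ) {𝔸 : Type*} {M : ℕ}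

open Classical in
/-- **NON-VACUITY.**  On the termless MODEL tower (every step `⟨PUnit, ∅, 0⟩`, activities `≡ 0`) both data of the ★ hold with `Hc ≡ 0`, `O = ℂ` (J31
`coordHolo_termlessStep`, J31b `coordHoloRel_termlessStep`), so the ★ FIRES there for any radius table, slope and amplitudes meeting the numerals — not a vacuous
implication; a model tower, NOT NODE 00's. [folklore] -/
theorem ne9_and_fadingMemory_termlessTower_vertex (p : RunPairing) {B : Type} (emb : B → CPair (F.P K) 𝔸) {γ κ A A' R r₁ ϱ ω c : ℝ} (hA : 0 ≤ A)
    (hA' : 0 < A') (hγ : 0 < γ) (hr₁ : 0 ≤ r₁) (hκ : κ ≤ r₁) (hrate : r₁ + 2 * (64 * Real.log 162) + 2 ≤ R)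
    (hsmall : 2 * (A' * γ) * Real.exp (5 * r₁ + 1) * K₀ 64 8 * 9 * 64 ≤ 1) (hϱ : 0 < ϱ) (hω : 0 < ω) (hω1 : ω ≤ 1) (hc : 0 < c) :
    NE9 (functionalOn (M := M) (fun k => (⟨PUnit, fun _ => ∅, fun _ _ _ => 0⟩ : ClusterStep (F.P K) 𝔸 M k)) p emb) (Window γ) κ
        (fun n i => 8 * (Real.exp 1 * 9 * 64 * K₀ 64 8 ^ 2) * (if i + 1 < n then 4 * A / (ϱ * (ω ^ (n - i))⁻¹) else 8 * A' / min c 1)) ∧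
      FadingMemory (8 * (Real.exp 1 * 9 * 64 * K₀ 64 8 ^ 2) * max (4 * A / ϱ) (8 * A' / min c 1 / ω)) ω
        (fun n i => 8 * (Real.exp 1 * 9 * 64 * K₀ 64 8 ^ 2) * (if i + 1 < n then 4 * A / (ϱ * (ω ^ (n - i))⁻¹) else 8 * A' / min c 1)) :=
  ne9_and_fadingMemory_functionalOn_of_coordHoloRadii_vertex F K _ p emb (fun _ _ => univ) (fun _ _ _ => mem_univ _) hA hA' hγ hr₁ hκ hrate hsmall hϱ
    hω hω1 hc (fun k i => ϱ * (ω ^ (k - i))⁻¹) (fun _ _ => mul_pos hϱ (inv_pos.2 (pow_pos hω _))) (fun _ _ _ => le_rfl)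
    (fun k g hg Z φ hφ i _ => by
      rw [box_eq_setOf_mem_Ioc] at hg
      exact coordHolo_termlessStep (fun _ => Ioc (0 : ℝ) γ) (fun _ => univ) hA R (fun i => ϱ * (ω ^ (k + 1 - (i : ℕ)))⁻¹) g hg Z φ hφ i)
    (fun k g hg Z φ hφ => coordHoloRel_termlessStep (fun _ => univ) hA'.le R c g hg Z φ hφ (Fin.last k))

end Rider

end YMDAG.N22.W1.CouplingRadii

end
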